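import Summits.HodgeConjecture.HodgeConjecture.Theorems.K2E1bArchPacketSignsDefs      -- ★ p855974 (U8-0): `IsRegularParam`, `casimirOf`, `centralOf`
import Literature.RepresentationTheory.Kovacevic2021.SU21PrincipalSeriesReducibility   -- ★ `acoef`, `bcoef` (root-line coefficients of `V(c,2t)`)
import HarnessLib

/-!
# K2 ∕ E1b unit U8 · LEVEL-B DICTIONARY — THEOREMS-SIDE DEFS LEAF `K2E1bDSCellParamsDefs`: the Kovačević parameters `(c_K, t)` of the three
# principal series through the discrete-series packet `Π(φ(a,b,c))` of `U(2,1)` (§0 of `Lines/K2_E1b_GKCohomologyU21_U8c_DSCellArithmetic.lean`, VERBATIM)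

Cell hodgecm-mathlib, Track B «K2-LIT», engine E1b; crux item h413 = stmt-HodgeConjecture-24833 (supports-only; a defs leaf closes nothing); line author
K2E1b-plan (g2); leaf typed by K2E4-p10 (g2) on the dealer's word «DEALER on … REPORT-FIRST Q4∕U8-3» 2026-09-04T00:42:43Z (2)(a) + K2E1b-r01 (g3) PRE-BOX
00:37:25Z (2).  K2-lead RULING R3 (d) «DEFS BEFORE SIGS IS HARD»: no `Theorems/` file may import a `Cruxes/…/Lines` module, so the six parameters that the
row-U8-3 carrier file `Theorems/K2E1bDSCellData.lean` and the arithmetic leaf `Theorems/K2E1bDSCellArithmetic.lean` name must live in a ★ leaf FIRST.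
THIS FILE is that leaf: §0 of the engine line's arithmetic module `Lines/K2_E1b_GKCohomologyU21_U8c_DSCellArithmetic.lean` (K2E1b-plan (g2), BY WRITE,
commit 76719c64e04a) VERBATIM — `tPlus`, `cKPlus`, `tMinus`, `cKMinus`, `tBox`, `cKBox` — SAME namespace `…Cruxes.H413.K2E1bGKCohomologyU21.U8.LevelB`,
same docstrings, so that U8c's ED. 2 imports this leaf and drops its local copies with statement bytes equal (the ★ p855974 ∕ ★ p856121 drill).
Definitions only; no theorem, no `sorry`, no axiom, no instance, no notation.

THE DICTIONARY (from U8c's docstring; derivation in the TABLE `Lines/K2_E1b_GKCohomologyU21_U8_ArchPacketSigns.md` §2b): Kovačević coordinates of ★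
`V(c,2t) = SU21Datum.principalSeries c t`: `K`-types `(n,m) = (1+p+q, 2t+3p−3q)`, `p,q ≥ 0`; ★ `acoef c t p = 2c − (p+1)t − p(p+2)`,
★ `bcoef c t q = 2c + (q+1)t − q(q+2)` [Kovacevic2021 §3 Thm 3 (b85)(b90)].
* `(+)`-series: `t⁺ = 2a − b − c`, `2c_K⁺ = (a−b−1)(a−b+1) − (a−b)(2a−b−c)` (`JH = {J_φ⁺, D_φ⁺, D_φ}` [Rogawski1990 §12.3 p. 177]);
* `(−)`-series: `t⁻ = −a − b + 2c`, `2c_K⁻ = (b−c−1)(b−c+1) + (b−c)(−a−b+2c)` (`{J_φ⁻, D_φ⁻, D_φ}`);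
* 4-cell series: `t″ = −a + 2b − c`, `2c″ = (a−b)(−a+2b−c) + (a−b−1)(a−b+1)` (`{F_φ, J_φ^±, D_φ}`).
(Rogawski1990, §12.3 pp. 176–177) (Kovacevic2021, §3 Thm 3; §6) (BorelWallach2000, VI §4 4.10) — arithmetic of the engine line (hence untagged).
HONEST LABEL: HC_CM is proved only modulo the 7 printed citations (2 remaining named inputs: hLiu418 = stmt-HodgeConjecture-24832, h413 =
stmt-HodgeConjecture-24833) until rung 0 closes; this file asserts nothing (definitions only).
-/

set_option autoImplicit false
set_option linter.dupNamespace false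

namespace Summit.HodgeConjecture.HodgeConjecture.Cruxes.H413.K2E1bGKCohomologyU21.U8.LevelB

/-! ## §0 The parameters (inline definitions of the engine line; plain integers ∕ complex numbers) -/

/-- `t⁺ = 2a − b − c`: the Kovačević parameter `t` of the `(+)`-series through `Π(φ(a,b,c))`. (Kovacevic2021, §3 Thm 3) (hence untagged) -/
def tPlus (a b c : ℤ) : ℤ := 2 * a - b - c

/-- `c_K⁺ = ((a−b−1)(a−b+1) − (a−b)(2a−b−c)) ∕ 2`: the Kovačević parameter `c` of the `(+)`-series. (Kovacevic2021, §3 Thm 3) (hence untagged) -/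
noncomputable def cKPlus (a b c : ℤ) : ℂ := (((a - b - 1) * (a - b + 1) - (a - b) * (2 * a - b - c) : ℤ) : ℂ) / 2

/-- `t⁻ = −a − b + 2c`: the parameter `t` of the `(−)`-series. (Kovacevic2021, §3 Thm 3) (hence untagged) -/
def tMinus (a b c : ℤ) : ℤ := -a - b + 2 * c

/-- `c_K⁻ = ((b−c−1)(b−c+1) + (b−c)(−a−b+2c)) ∕ 2`: the parameter `c` of the `(−)`-series. (Kovacevic2021, §3 Thm 3) (hence untagged) -/
noncomputable def cKMinus (a b c : ℤ) : ℂ := (((b - c - 1) * (b - c + 1) + (b - c) * (-a - b + 2 * c) : ℤ) : ℂ) / 2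

/-- `t″ = −a + 2b − c`: the parameter `t` of the 4-cell series (the one containing `F_φ`). (Kovacevic2021, §3 Thm 3) (hence untagged) -/
def tBox (a b c : ℤ) : ℤ := -a + 2 * b - c

/-- `c″ = ((a−b)(−a+2b−c) + (a−b−1)(a−b+1)) ∕ 2`: the parameter `c` of the 4-cell series. (Kovacevic2021, §3 Thm 3) (hence untagged) -/
noncomputable def cKBox (a b c : ℤ) : ℂ := (((a - b) * (-a + 2 * b - c) + (a - b - 1) * (a - b + 1) : ℤ) : ℂ) / 2


end Summit.HodgeConjecture.HodgeConjecture.Cruxes.H413.K2E1bGKCohomologyU21.U8.LevelB
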